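import Literature.Analysis.UnboundedOperators.SpectralGap
import Literature.Analysis.InnerProduct.KyFanOrthonormal
import HarnessLib

/-!
# The form gap above a ground state in Ky Fan form

Topic `Literature/Analysis/UnboundedOperators`; companion of `SpectralGap.lean`
(`LinearPMap.HasFormGap A Ω Δ`: `A ≥ 0`, `A Ω = 0`, `A ≥ Δ` in the form sense on `dom A ∩ {Ω}ᗮ`)
and of `Literature/Analysis/InnerProduct/KyFanOrthonormal.lean`. The tree phrases "the first
excited level of `H` lies `≥ Δ` above the ground state" in two ways: as a FORM GAP relative to a
known ground state `Ω` (`HasFormGap`, the constructive-QFT / Hubbard statements), and in KY FAN FORM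
"`⟨x₁, H x₁⟩ + ⟨x₂, H x₂⟩ ≥ 2E₀ + Δ` for all orthonormal pairs `x₁, x₂` in a core", which needs no
ground state vector (`…QuantumManyBody.BoseGas.kyFanTwo`, `…BoccatoEtAl2019_firstGap_GP`,
`…BoccatoEtAl2019Acta_firstExcitation`). This file proves the two are equivalent for a positive
partially defined operator with a kernel vector `Ω` (Reed–Simon IV, Thm. XIII.1 (min–max) for the
two lowest levels `0` and `≥ Δ`):

* `LinearPMap.re_inner_apply_ge_of_hasFormGap` — the one-vector estimate
  `Δ (‖x‖² - |⟪Ω̂, x⟫|²) ≤ re ⟪x, A x⟫` (`Ω̂ = Ω/‖Ω‖`): project `x` onto `{Ω}ᗮ`, where `A ≥ Δ`, and use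
  `A Ω = 0` with the symmetry of `A`;
* `LinearPMap.HasFormGap.kyFan_two_le` — **`Δ ≤ re ⟪x₁, A x₁⟫ + re ⟪x₂, A x₂⟫` for every orthonormal
  pair in `dom A`** (sum the one-vector estimates and use Bessel for the pair against `Ω̂`,
  `|⟪Ω̂, x₁⟫|² + |⟪Ω̂, x₂⟫|² ≤ 1`);
* `LinearPMap.hasFormGap_iff_kyFan_two` — conversely the Ky Fan inequality on orthonormal pairs gives
  the form gap (test the pair `(Ω̂, x)`, `x ⊥ Ω`), so for `A ≥ 0` with `A Ω = 0`, `Ω ≠ 0`, `0 < Δ`: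
  `A.HasFormGap Ω Δ ↔ ∀ orthonormal x₁, x₂ ∈ dom A, Δ ≤ re ⟪x₁, A x₁⟫ + re ⟪x₂, A x₂⟫`.

Deliberate dot-notation extensions in Mathlib's `namespace LinearPMap`, as in `SpectralGap.lean`.
No definitions, no named facts.

## References

* M. Reed, B. Simon, *Methods of Modern Mathematical Physics IV* (1978), §XIII.1, Thm. XIII.1–2
  (min–max), §XIII.12 (non-degenerate ground states). [ReedSimonIV1978]
* Ky Fan, Proc. Nat. Acad. Sci. USA 35 (1949) 652–655, Thm. 1. [folklore form]
* C. Boccato, C. Brennecke, S. Cenatiempo, B. Schlein, Acta Math. 222 (2019), §6 [BoccatoEtAl2019Acta]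
  (the Ky-Fan phrasing of the first Bogoliubov gap served by this equivalence).
-/

noncomputable section

open RCLike Submodule
open scoped ComplexConjugate InnerProductSpace

namespace LinearPMap

variable {𝕜 E : Type*} [RCLike 𝕜] [NormedAddCommGroup E] [InnerProductSpace 𝕜 E]

/-- (Dot-notation extension of Mathlib's `LinearPMap`.) For a symmetric `A` and a kernel vector
`Ω ∈ dom A` (`A Ω = 0`), removing the `Ω`-component does not change the form:
`⟪x, A x⟫ = ⟪y, A y⟫` for `y = x - ⟪Ω̂, x⟫ Ω̂`, and `‖x‖² = ‖y‖² + |⟪Ω̂, x⟫|²`, `y ⊥ Ω`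
(`Ω̂ = ‖Ω‖⁻¹ Ω`). [folklore] -/
theorem inner_apply_eq_of_apply_eq_zero {A : E →ₗ.[𝕜] E} (hA : A.IsSymmetric) {Ω : E}
    (hΩ : Ω ≠ 0) (hΩd : Ω ∈ A.domain) (hAΩ : A ⟨Ω, hΩd⟩ = 0) (x : A.domain) :
    let u : E := ((‖Ω‖⁻¹ : ℝ) : 𝕜) • Ω
    let y : A.domain := x - (⟪u, (x : E)⟫_𝕜 * ((‖Ω‖⁻¹ : ℝ) : 𝕜)) • (⟨Ω, hΩd⟩ : A.domain)
    ⟪(x : E), A x⟫_𝕜 = ⟪(y : E), A y⟫_𝕜 ∧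
      ‖(x : E)‖ ^ 2 = ‖(y : E)‖ ^ 2 + ‖⟪u, (x : E)⟫_𝕜‖ ^ 2 ∧ ⟪Ω, (y : E)⟫_𝕜 = 0 := by
  intro u y
  have hu : ‖u‖ = 1 := by
    simp only [u]
    rw [norm_smul, RCLike.norm_ofReal, abs_of_nonneg (inv_nonneg.2 (norm_nonneg Ω)),
      inv_mul_cancel₀ (norm_ne_zero_iff.2 hΩ)]
  have hyE : (y : E) = (x : E) - ⟪u, (x : E)⟫_𝕜 • u := by
    simp only [y, u, Submodule.coe_sub, Submodule.coe_smul, smul_smul]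
  have hAy : A y = A x := by
    simp only [y, map_sub, map_smul, hAΩ, smul_zero, sub_zero]
  -- `y ⊥ u` (hence `y ⊥ Ω`)
  have huy : ⟪u, (y : E)⟫_𝕜 = 0 := by
    rw [hyE, inner_sub_right, inner_smul_right, inner_self_eq_norm_sq_to_K, hu]
    simp
  have hΩy : ⟪Ω, (y : E)⟫_𝕜 = 0 := by
    have : Ω = ((‖Ω‖ : ℝ) : 𝕜) • u := by
      simp only [u, smul_smul]
      rw [← RCLike.ofReal_mul, mul_inv_cancel₀ (norm_ne_zero_iff.2 hΩ), RCLike.ofReal_one, one_smul]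
    rw [this, inner_smul_left, huy, mul_zero]
  refine ⟨?_, ?_, hΩy⟩
  · -- `⟪x, A x⟫ = ⟪y + α u, A y⟫ = ⟪y, A y⟫ + conj α ⟪u, A y⟫`, and `⟪u, A y⟫ = ‖Ω‖⁻¹ ⟪A Ω, y⟫ = 0`
    have hxE : (x : E) = (y : E) + ⟪u, (x : E)⟫_𝕜 • u := by rw [hyE, sub_add_cancel]
    have huAy : ⟪u, A y⟫_𝕜 = 0 := by
      have hsym : ⟪A ⟨Ω, hΩd⟩, (y : E)⟫_𝕜 = ⟪Ω, A y⟫_𝕜 := hA ⟨Ω, hΩd⟩ y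
      rw [hAΩ, inner_zero_left] at hsym
      simp only [u, inner_smul_left, ← hsym, mul_zero]
    rw [← hAy]
    conv_lhs => rw [hxE]
    rw [inner_add_left, inner_smul_left, huAy, mul_zero, add_zero]
  · -- Pythagoras for `x = y + α u`, `y ⊥ u`, `‖u‖ = 1`
    have hxE : (x : E) = ⟪u, (x : E)⟫_𝕜 • u + (y : E) := by rw [hyE, add_sub_cancel]
    have horth : ⟪⟪u, (x : E)⟫_𝕜 • u, (y : E)⟫_𝕜 = 0 := by
      rw [inner_smul_left, huy, mul_zero]
    conv_lhs => rw [hxE]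
    rw [sq, sq, sq, norm_add_sq_eq_norm_sq_add_norm_sq_of_inner_eq_zero _ _ horth, norm_smul, hu,
      mul_one, add_comm]

/-- (Dot-notation extension of Mathlib's `LinearPMap`.) **One-vector form of the gap.** If `A` has a
form gap `Δ` above the ground state `Ω` (`LinearPMap.HasFormGap`), then for every `x ∈ dom A`,
`Δ (‖x‖² - |⟪Ω̂, x⟫|²) ≤ re ⟪x, A x⟫` with `Ω̂ = ‖Ω‖⁻¹ Ω`, i.e. `A ≥ Δ (1 - |Ω̂⟩⟨Ω̂|)` in the form
sense (Reed–Simon IV, §XIII.1). [cite: ReedSimonIV1978, §XIII.1 Theorem XIII.1] -/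
theorem re_inner_apply_ge_of_hasFormGap {A : E →ₗ.[𝕜] E} {Ω : E} {Δ : ℝ} (h : A.HasFormGap Ω Δ)
    (x : A.domain) :
    Δ * (‖(x : E)‖ ^ 2 - ‖⟪((‖Ω‖⁻¹ : ℝ) : 𝕜) • Ω, (x : E)⟫_𝕜‖ ^ 2) ≤ re ⟪(x : E), A x⟫_𝕜 := by
  obtain ⟨hpos, hΩ, ⟨hΩd, hAΩ⟩, _, hbd⟩ := h
  obtain ⟨hform, hnorm, hΩy⟩ := inner_apply_eq_of_apply_eq_zero hpos.isSymmetric hΩ hΩd hAΩ x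
  rw [hform]
  have hy := hbd _ (Submodule.mem_orthogonal_singleton_iff_inner_right.2 hΩy)
  refine le_trans (le_of_eq ?_) hy
  rw [hnorm]
  ring

/-- (Dot-notation extension of Mathlib's `LinearPMap`.) **A form gap in Ky Fan form.** If `A` has a
form gap `Δ` above the ground state `Ω`, then for every orthonormal pair `x₁, x₂` in `dom A`,
`Δ ≤ re ⟪x₁, A x₁⟫ + re ⟪x₂, A x₂⟫` — the sum of the two lowest levels (`0` and `≥ Δ`) bounds the
form on orthonormal pairs from below (Ky Fan / min–max for `k = 2`, Reed–Simon IV, Thm. XIII.1):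
add the one-vector estimates and use Bessel's inequality for the pair against `Ω̂`,
`|⟪Ω̂, x₁⟫|² + |⟪Ω̂, x₂⟫|² ≤ 1`. [cite: ReedSimonIV1978, §XIII.1 Theorem XIII.1] -/
theorem HasFormGap.kyFan_two_le {A : E →ₗ.[𝕜] E} {Ω : E} {Δ : ℝ} (h : A.HasFormGap Ω Δ)
    (x₁ x₂ : A.domain) (h₁ : ‖(x₁ : E)‖ = 1) (h₂ : ‖(x₂ : E)‖ = 1)
    (h₁₂ : ⟪(x₁ : E), (x₂ : E)⟫_𝕜 = 0) :
    Δ ≤ re ⟪(x₁ : E), A x₁⟫_𝕜 + re ⟪(x₂ : E), A x₂⟫_𝕜 := by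
  have hΔ : 0 < Δ := h.2.2.2.1
  have hΩ : Ω ≠ 0 := h.2.1
  have e₁ := re_inner_apply_ge_of_hasFormGap h x₁
  have e₂ := re_inner_apply_ge_of_hasFormGap h x₂
  have hB := Literature.Analysis.InnerProduct.norm_inner_sq_add_norm_inner_sq_le (𝕜 := 𝕜) h₁ h₂ h₁₂
    (((‖Ω‖⁻¹ : ℝ) : 𝕜) • Ω)
  have hu : ‖((‖Ω‖⁻¹ : ℝ) : 𝕜) • Ω‖ = 1 := by
    rw [norm_smul, RCLike.norm_ofReal, abs_of_nonneg (inv_nonneg.2 (norm_nonneg Ω)),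
      inv_mul_cancel₀ (norm_ne_zero_iff.2 hΩ)]
  rw [h₁, one_pow] at e₁
  rw [h₂, one_pow] at e₂
  rw [hu, one_pow] at hB
  nlinarith

/-- (Dot-notation extension of Mathlib's `LinearPMap`.) **Form gap ⟺ Ky Fan gap.** For a positive
partially defined operator `A` with a kernel vector `Ω ≠ 0` (`A Ω = 0`) and `Δ > 0`, the form gap
`A ≥ Δ` on `dom A ∩ {Ω}ᗮ` (`LinearPMap.HasFormGap A Ω Δ`) is equivalent to the Ky Fan inequality
`Δ ≤ re ⟪x₁, A x₁⟫ + re ⟪x₂, A x₂⟫` for all orthonormal pairs `x₁, x₂ ∈ dom A` (the two lowest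
levels of `A` are `0` and `≥ Δ`; Reed–Simon IV, Thm. XIII.1). The converse tests the pair `(Ω̂, x)`
with `x ⊥ Ω` a unit vector. [cite: ReedSimonIV1978, §XIII.1 Theorem XIII.1] -/
theorem hasFormGap_iff_kyFan_two {A : E →ₗ.[𝕜] E} (hA : A.IsPositive) {Ω : E} (hΩ : Ω ≠ 0)
    (hΩd : Ω ∈ A.domain) (hAΩ : A ⟨Ω, hΩd⟩ = 0) {Δ : ℝ} (hΔ : 0 < Δ) :
    A.HasFormGap Ω Δ ↔
      ∀ x₁ x₂ : A.domain, ‖(x₁ : E)‖ = 1 → ‖(x₂ : E)‖ = 1 → ⟪(x₁ : E), (x₂ : E)⟫_𝕜 = 0 →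
        Δ ≤ re ⟪(x₁ : E), A x₁⟫_𝕜 + re ⟪(x₂ : E), A x₂⟫_𝕜 := by
  refine ⟨fun h x₁ x₂ h₁ h₂ h₁₂ => h.kyFan_two_le x₁ x₂ h₁ h₂ h₁₂, fun h => ?_⟩
  refine ⟨hA, hΩ, ⟨hΩd, hAΩ⟩, hΔ, fun x hx => ?_⟩
  -- the gap inequality on `dom A ∩ {Ω}ᗮ`: scale `x` to a unit vector and test the pair `(Ω̂, x̂)`
  by_cases hx0 : (x : E) = 0
  · rw [hx0, norm_zero, zero_pow two_ne_zero, mul_zero]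
    have : (x : A.domain) = 0 := by ext; exact hx0
    rw [this, LinearPMap.map_zero, inner_zero_right]
    simp
  have hxn : ‖(x : E)‖ ≠ 0 := norm_ne_zero_iff.2 hx0
  -- unit vectors `Ω̂ = ‖Ω‖⁻¹ Ω` and `x̂ = ‖x‖⁻¹ x` in `dom A`
  set cΩ : 𝕜 := ((‖Ω‖⁻¹ : ℝ) : 𝕜) with hcΩ
  set cx : 𝕜 := ((‖(x : E)‖⁻¹ : ℝ) : 𝕜) with hcx
  have hu : ‖((cΩ • (⟨Ω, hΩd⟩ : A.domain) : A.domain) : E)‖ = 1 := by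
    rw [Submodule.coe_smul, norm_smul, hcΩ, RCLike.norm_ofReal,
      abs_of_nonneg (inv_nonneg.2 (norm_nonneg Ω)), inv_mul_cancel₀ (norm_ne_zero_iff.2 hΩ)]
  have hv : ‖((cx • x : A.domain) : E)‖ = 1 := by
    rw [Submodule.coe_smul, norm_smul, hcx, RCLike.norm_ofReal,
      abs_of_nonneg (inv_nonneg.2 (norm_nonneg _)), inv_mul_cancel₀ hxn]
  have hΩx : ⟪Ω, (x : E)⟫_𝕜 = 0 := Submodule.mem_orthogonal_singleton_iff_inner_right.1 hx
  have huv : ⟪((cΩ • (⟨Ω, hΩd⟩ : A.domain) : A.domain) : E), ((cx • x : A.domain) : E)⟫_𝕜 = 0 := by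
    rw [Submodule.coe_smul, Submodule.coe_smul, inner_smul_left, inner_smul_right]
    simp [hΩx]
  have key := h _ _ hu hv huv
  -- the `Ω̂` term vanishes, the `x̂` term is `‖x‖⁻² re ⟪x, A x⟫`
  have hΩterm : re ⟪((cΩ • (⟨Ω, hΩd⟩ : A.domain) : A.domain) : E),
      A (cΩ • (⟨Ω, hΩd⟩ : A.domain))⟫_𝕜 = 0 := by
    rw [map_smul, hAΩ, smul_zero, inner_zero_right]
    simp
  have hxterm : re ⟪((cx • x : A.domain) : E), A (cx • x)⟫_𝕜 =
      ‖(x : E)‖⁻¹ ^ 2 * re ⟪(x : E), A x⟫_𝕜 := by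
    rw [map_smul, Submodule.coe_smul, inner_smul_left, inner_smul_right, hcx, RCLike.conj_ofReal,
      ← mul_assoc, ← RCLike.ofReal_mul, RCLike.re_ofReal_mul, sq]
  rw [hΩterm, zero_add, hxterm] at key
  -- `Δ ≤ ‖x‖⁻² re ⟪x, A x⟫` ⟹ `Δ ‖x‖² ≤ re ⟪x, A x⟫`
  have hpos : 0 < ‖(x : E)‖ ^ 2 := by positivity
  rw [inv_pow, ← div_eq_inv_mul, le_div_iff₀ hpos] at key
  exact key

end LinearPMap

end
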